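import Summits.KontsevichZagierPeriods.KontsevichZagierPeriods.Theses.DessinsDimensionOne
import Summits.KontsevichZagierPeriods.KontsevichZagierPeriods.Theses.BianchiHumbert
import Summits.KontsevichZagierPeriods.KontsevichZagierPeriods.Theses.HodgeLevel
import Literature.NumberTheory.Transcendental.KZRelationsLE

/-!
# Line `bounded_solids` — skeleton for the piece `KZDimTwo` (stmt-KontsevichZagierPeriods-4280, shared)
# of the BC2 split of `DessinsDimensionOne.ExcursionBudget` (stmt-KontsevichZagierPeriods-6259)

`KZDimTwo`: Conjecture 1 on the stratum of dimension `≤ 2`.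
Line: VOLUMES OF BOUNDED SOLIDS ("Hilbert's third problem for bounded `ℚ`-semialgebraic solids in
`ℝ³`, inside KZ's calculus"). Supersedes the strategist's birth skeleton `kzdimtwo_solids_birth`
(finite-volume solids): with the tree's `KZ.exists_sub_isBounded` (Viu-Sos 2021 Cor. 2.3,
resolution-free tree proof in `KZVolumeConjectureProofs.lean`) the reduction stub is provable NOW and
boundedness makes the merging stub elementary.

* `stub_solids` — a representation of dimension `≤ 2` is KZ-equivalent to a difference of two BOUNDED
  volume representations (integrand `1`) of dimension `3` (`KZ.exists_sub_isBounded` in dimension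
  `n + 1`, then unit slabs up to dimension `3`, `KZ.IntegralRep.equivalent_slab`). Provable now, M.
* `stub_mergeSolids` — two bounded volume representations of dimension `3` merge into one (translate
  one past a bounding box of the other, rule (2) with Jacobian `1`; disjoint union, rule (1a)).
  Provable now, M.
* `stub_solidVolumes` — THE OPEN CONTENT: two bounded volume representations of dimension `3` with
  the same volume are KZ-equivalent (the dimension-`3` layer of the Cresson–Viu-Sos volume conjecture;
  its all-dimension form `KZ.volumeConjectureCompact` is summit-equivalent by the landed
  `KZ.kzPeriodConjecture'_iff_volumeConjectureCompact_holds` and is NOT used).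
* `equivalent_of_stubs` (sorry-free implication: stub statements ⟹ equivalence of equal-valued
  representations of dimensions `≤ 2`) and `KZDimTwo_of` (the skeleton: stubs by name ⟹ the route
  decl by name) — real proof: reduce both sides to differences of bounded solids, cross-merge,
  compare volumes by soundness (`KZ.relations_le_ker_eval_holds`), apply `stub_solidVolumes`,
  reassemble in the free abelian group. Conclusion: literally the route decl
  `Summit.KontsevichZagierPeriods.KontsevichZagierPeriods.Theses.DessinsDimensionOne.KZDimTwo`
  (the shared item stmt-4280's primary decl is `Theses.BianchiHumbert.KZDimTwo`, the same statement;
  `ledger skeleton check … --crux-decl` selects this one).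

Sources: KontsevichZagier2001 §1.2; ViuSos2021 Thm 1.1 / Cor 2.3; CressonViusos2022 §1 p. 326;
Sydler 1965 / Jessen 1968 (Dehn–Sydler: equal volume alone does not give scissors congruence in ℝ³ —
the KZ-equivalence must use Newton–Leibniz moves, which kill Dehn invariants of rational polytopes).
-/

namespace Summit.KontsevichZagierPeriods.KontsevichZagierPeriods.Cruxes.KZDimTwo.BoundedSolids

open Literature.NumberTheory.Transcendental
open Summit.KontsevichZagierPeriods.KontsevichZagierPeriods.Theses.DessinsDimensionOne (KZDimTwo)

/-- A *bounded volume representation*: bounded domain, integrand `1` on the domain. -/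
def IsBoundedVolume {N : ℕ} (s : KZ.IntegralRep N) : Prop :=
  Bornology.IsBounded s.domain ∧ ∀ z ∈ s.domain, s.integrand z = 1

/-- STUB 1 (bounded solids, provable now from `KZ.exists_sub_isBounded` + unit slabs, M): a
representation of dimension `≤ 2` is KZ-equivalent to a difference of two bounded volume
representations of dimension `3`. -/
theorem stub_solids : ∀ ⦃n : ℕ⦄, n ≤ 2 → ∀ (r : KZ.IntegralRep n),
    ∃ (s s' : KZ.IntegralRep 3), IsBoundedVolume s ∧ IsBoundedVolume s' ∧
      KZ.of r - (KZ.of s - KZ.of s') ∈ KZ.relations := by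
  sorry

/-- STUB 2 (merging bounded solids, provable now, M): two bounded volume representations of
dimension `3` merge into one (disjoint translated union). -/
theorem stub_mergeSolids : ∀ (s t : KZ.IntegralRep 3), IsBoundedVolume s → IsBoundedVolume t →
    ∃ u : KZ.IntegralRep 3, IsBoundedVolume u ∧ KZ.of u - KZ.of s - KZ.of t ∈ KZ.relations := by
  sorry

/-- STUB 3 (THE OPEN CONTENT): Hilbert's third problem for bounded `ℚ`-semialgebraic solids in KZ's
calculus — two bounded volume representations of dimension `3` with equal volumes are KZ-equivalent. -/
theorem stub_solidVolumes : ∀ (u v : KZ.IntegralRep 3), IsBoundedVolume u → IsBoundedVolume v →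
    u.value = v.value → KZ.Equivalent u v := by
  sorry

/-- Soundness in value form: a relation evaluates to `0`. -/
theorem eval_eq_zero_of_mem {c : KZ.FormalRep} (hc : c ∈ KZ.relations) : KZ.eval c = 0 :=
  (AddMonoidHom.mem_ker).mp (KZ.relations_le_ker_eval_holds hc)

/-- THE COMPOSITION AS A SORRY-FREE IMPLICATION (stub statements ⟹ the stratum, for representations of
dimensions `n, m ≤ 2` with equal values; `IsRational` is not needed): bounded solids + merging +
Hilbert-3-for-bounded-solids. Axioms: propext / Classical.choice / Quot.sound only. -/
theorem equivalent_of_stubs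
    (h1 : ∀ ⦃n : ℕ⦄, n ≤ 2 → ∀ (r : KZ.IntegralRep n),
      ∃ (s s' : KZ.IntegralRep 3), IsBoundedVolume s ∧ IsBoundedVolume s' ∧
        KZ.of r - (KZ.of s - KZ.of s') ∈ KZ.relations)
    (h2 : ∀ (s t : KZ.IntegralRep 3), IsBoundedVolume s → IsBoundedVolume t →
      ∃ u : KZ.IntegralRep 3, IsBoundedVolume u ∧ KZ.of u - KZ.of s - KZ.of t ∈ KZ.relations)
    (h3 : ∀ (u v : KZ.IntegralRep 3), IsBoundedVolume u → IsBoundedVolume v →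
      u.value = v.value → KZ.Equivalent u v)
    {n m : ℕ} (hn : n ≤ 2) (hm : m ≤ 2) (r : KZ.IntegralRep n) (r' : KZ.IntegralRep m)
    (hv : r.value = r'.value) : KZ.Equivalent r r' := by
  obtain ⟨s, s', hs, hs', hrs⟩ := h1 hn r
  obtain ⟨t, t', ht, ht', hrt⟩ := h1 hm r'
  -- cross-merge: u = s ⊔ t', v = t ⊔ s'
  obtain ⟨u, hu, hum⟩ := h2 s t' hs ht'
  obtain ⟨v, hvv, hvm⟩ := h2 t s' ht hs'
  -- volumes agree: value u = s + t' = t + s' = value v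
  have e1 := eval_eq_zero_of_mem hrs
  have e2 := eval_eq_zero_of_mem hrt
  have e3 := eval_eq_zero_of_mem hum
  have e4 := eval_eq_zero_of_mem hvm
  simp only [map_sub, KZ.eval_of] at e1 e2 e3 e4
  have huv : u.value = v.value := by linarith
  have hE : KZ.of u - KZ.of v ∈ KZ.relations := h3 u v hu hvv huv
  -- reassemble `[r] − [r']` from the five relations
  have e : KZ.of r - KZ.of r' =
      (KZ.of r - (KZ.of s - KZ.of s')) - (KZ.of r' - (KZ.of t - KZ.of t'))
        + (KZ.of u - KZ.of v) - (KZ.of u - KZ.of s - KZ.of t') + (KZ.of v - KZ.of t - KZ.of s') := by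
    abel
  show KZ.of r - KZ.of r' ∈ KZ.relations
  rw [e]
  exact add_mem (sub_mem (add_mem (sub_mem hrs hrt) hE) hum) hvm

/-- THE SKELETON (concludes the item's primary decl `Theses.BianchiHumbert.KZDimTwo` BY NAME from the
three stubs BY NAME; stmt-4280 is shared by BianchiHumbert / HodgeLevel / DessinsDimensionOne). -/
theorem KZDimTwo_of : Summit.KontsevichZagierPeriods.KontsevichZagierPeriods.Theses.BianchiHumbert.KZDimTwo :=
  fun _ _ hn hm r r' _ _ hv => equivalent_of_stubs stub_solids stub_mergeSolids stub_solidVolumes hn hm r r' hv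

/-- The same skeleton concluding the DessinsDimensionOne copy of the shared decl. -/
theorem KZDimTwo_of_dessins : KZDimTwo :=
  fun _ _ hn hm r r' _ _ hv => equivalent_of_stubs stub_solids stub_mergeSolids stub_solidVolumes hn hm r r' hv

/-- … and the HodgeLevel copy (`DimTwoRationalStratum`, crux 2 of the open route HodgeLevel). -/
theorem KZDimTwo_of_hodgeLevel :
    Summit.KontsevichZagierPeriods.KontsevichZagierPeriods.Theses.HodgeLevel.DimTwoRationalStratum :=
  fun _ _ hn hm r r' _ _ hv => equivalent_of_stubs stub_solids stub_mergeSolids stub_solidVolumes hn hm r r' hv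

end Summit.KontsevichZagierPeriods.KontsevichZagierPeriods.Cruxes.KZDimTwo.BoundedSolids
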